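import Summits.BirchSwinnertonDyer.Rank1Residual.X2.TrivialZeroStrictInclusionDerived
import HarnessLib

/-!
# The Greenberg datum at an odd SPLIT multiplicative prime is UNIQUE: every datum with
# inertia-trivial quotient and `#(C' ∩ E[p^∞][p]) = p` IS the Tate line `C = ι⁻¹Φ(μ) ≅ μ_{p^∞}`

HONEST FRAMING (BSD rank-`≤ 1` residual cell `b2b-bsdres`, home
`run/shared/lean/b2b/bsd-rank1-residual/`, unit `b2b-bsdres-eisenstein-p2`, class X2 = odd
multiplicative Eisenstein primes; research route, no claim beyond stated classes; nothing booked;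
labels are the referee's): the cell deletes the COMBINATION-SHAPED residual classes of the
rank-`≤ 1` BSD formula from PUBLISHED theorems only and TYPES the construction-shaped ones; this is
not "finishing BSD". THEOREMS ONLY (no definition, no named fact, nothing asserted).

## What

The X2 Literature records at `p ‖ N` (A133 `lambda_nonPrimitive_eq_add_sum_delta_multiplicative`,
A135, A137, A137′, T-GV23L's multiplicative instances) quantify over Greenberg data `L` with
"`C = (L v hv).plus` divisible, `#(C ∩ A[p]) = p`, inertia (resp. decomposition) group trivial on
`A/C`", glossed in every docstring as "at a multiplicative prime these pin down the (untwisted) Tate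
datum". Gen 27's `TrivialZeroStrictInclusionDerived.tateDatum_plus_le_of_inertia` proved the Tate
line `C` lies INSIDE every such `C'`. This file finishes the gloss as a theorem:

* §1 `eq_of_le_of_divisible_of_card_eq` — pure group theory: in a `p`-primary abelian group, if
  `C ≤ C'`, `C` is `p`-divisible and the finite groups `C[p] ⊆ C'[p]` have the same cardinality,
  then `C = C'` (induction on the exponent: `p^k m = 0`, `m ∈ C'` ⟹ `pm ∈ C` ⟹ `pm = pc`,
  `m − c ∈ C'[p] = C[p]`).
* §2 **`plus_eq_tateDatum_plus_of_inertia`** — at an odd `v ∋ p` with a Tate parametrisation, a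
  local datum `C'` with inertia-trivial quotient and `#(C' ∩ E[p^∞][p]) = p` EQUALS the Tate datum
  (`tateDatum_plus_divisible`, `natCard_tateDatum_plus_inf_torsionBy`, gen 13).
* §3 **`plus_eq_plus_of_inertia_of_split`** — granted A40, at an odd split `p ‖ N` any two Greenberg
  data of `E[p^∞]` with inertia-trivial quotients and `#(C ∩ A[p]) = p` COINCIDE above `p`; with
  `exists_data_of_split` (gen 13) this is existence-and-uniqueness of GV's datum at a split prime.

References: Greenberg–Vatsal 2000 §2 pp. 14–16 ("`C ≅ μ_{p^∞}`, `D = A/C ≅ ℚ_p/ℤ_p` unramified";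
"`V_p` contains an `𝓕_p`-subspace `W_p` of dimension `d⁺` invariant under `G_{ℚ_p}`");
Greenberg LNM 1716 p. 93; Silverman *ATAEC* V.3.1/V.5.3; Serre *Abelian ℓ-adic representations*
IV A.1.2 (the Tate module of a Tate curve is a non-split extension).
-/

noncomputable section

open scoped Classical AddSubgroup

universe u

namespace Summit.BirchSwinnertonDyer.Rank1Residual.X2.TateLineUnique

open NumberField IsDedekindDomain Field WeierstrassCurve
  Literature.NumberTheory.GaloisRepresentations
  Literature.NumberTheory.EllipticCurves Literature.NumberTheory.EllipticCurves.GreenbergSelmer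
  Literature.NumberTheory.EllipticCurves.GreenbergVatsal2000 IsDedekindDomain.HeightOneSpectrum
  Summit.BirchSwinnertonDyer.Rank1Residual.X2.GreenbergVatsalTorsion
  Summit.BirchSwinnertonDyer.Rank1Residual.X2.GreenbergVatsalTateDatum
  Summit.BirchSwinnertonDyer.Rank1Residual.X2.GreenbergVatsalTateDatumSign
  Summit.BirchSwinnertonDyer.Rank1Residual.X2.GreenbergVatsalTateDatumCofree
  Summit.BirchSwinnertonDyer.Rank1Residual.X2.GreenbergVatsalStrictSelmerMultiplicative
  Summit.BirchSwinnertonDyer.Rank1Residual.X2.TrivialZeroStrictInclusionDerived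

/-! ## §1. Group theory: a divisible subgroup with the same `p`-torsion is everything -/

/-- **In a `p`-primary abelian group, `C ≤ C'`, `C` `p`-divisible and `#C[p] = #C'[p]` (finite)
imply `C = C'`.** Induction on `k` with `p^k m = 0`: for `m ∈ C'`, `pm ∈ C` by induction, `pm = pc`
with `c ∈ C` by divisibility, and `m − c ∈ C' ∩ M[p] = C ∩ M[p]` by the cardinality hypothesis.
[folklore] -/
theorem eq_of_le_of_divisible_of_card_eq {M : Type*} [AddCommGroup M] (p : ℕ)
    {C C' : AddSubgroup M} (hle : C ≤ C') (hprim : ∀ m ∈ C', ∃ k : ℕ, p ^ k • m = 0)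
    (hdiv : ∀ c ∈ C, ∃ c' ∈ C, p • c' = c) (hne : Nat.card ↥(C' ⊓ M[(p : ℤ)]) ≠ 0)
    (hcard : Nat.card ↥(C ⊓ M[(p : ℤ)]) = Nat.card ↥(C' ⊓ M[(p : ℤ)])) : C = C' := by
  haveI : Finite ↥(C' ⊓ M[(p : ℤ)]) := Nat.finite_of_card_ne_zero hne
  have htors : C ⊓ M[(p : ℤ)] = C' ⊓ M[(p : ℤ)] :=
    AddSubgroup.eq_of_le_of_card_ge (inf_le_inf_right _ hle) hcard.ge
  refine le_antisymm hle ?_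
  -- `P k`: every `m ∈ C'` with `p^k m = 0` lies in `C`
  have key : ∀ (k : ℕ) (m : M), m ∈ C' → p ^ k • m = 0 → m ∈ C := by
    intro k
    induction k with
    | zero =>
      intro m _ hm
      rw [pow_zero, one_smul] at hm
      rw [hm]; exact C.zero_mem
    | succ k ih =>
      intro m hm hpm
      have hpm' : p ^ k • (p • m) = 0 := by rw [← mul_smul, ← pow_succ, hpm]
      obtain ⟨c, hc, hpc⟩ := hdiv _ (ih (p • m) (C'.nsmul_mem hm p) hpm')
      have hmc : m - c ∈ C ⊓ M[(p : ℤ)] := by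
        rw [htors]
        refine ⟨C'.sub_mem hm (hle hc), AddSubgroup.torsionBy.nsmul_iff.mpr ?_⟩
        rw [smul_sub, hpc, sub_self]
      have h := C.add_mem hmc.1 hc
      rwa [sub_add_cancel] at h
  intro m hm
  obtain ⟨k, hk⟩ := hprim m hm
  exact key k m hm hk

/-! ## §2. A local datum with inertia-trivial quotient and `#C'[p] = p` IS the Tate datum -/

section Tate

variable (W : WeierstrassCurve ℚ) [W.IsElliptic] (p : ℕ) [hp : Fact p.Prime]
  {v : HeightOneSpectrum (𝓞 ℚ)}
  (Φ : Additive (AlgebraicClosure (v.adicCompletion ℚ))ˣ →+ localPoints W (v.adicCompletion ℚ))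
  (hΦ : ∀ (σ : absoluteGaloisGroup (v.adicCompletion ℚ))
    (u : (AlgebraicClosure (v.adicCompletion ℚ))ˣ),
    σ • Φ (Additive.ofMul u) = Φ (Additive.ofMul (Units.map
      (Field.absoluteGaloisGroup.toAlgEquiv (v.adicCompletion ℚ) σ :
        AlgebraicClosure (v.adicCompletion ℚ) →* AlgebraicClosure (v.adicCompletion ℚ)) u)) ∨
    σ • Φ (Additive.ofMul u) = -Φ (Additive.ofMul (Units.map
      (Field.absoluteGaloisGroup.toAlgEquiv (v.adicCompletion ℚ) σ :
        AlgebraicClosure (v.adicCompletion ℚ) →* AlgebraicClosure (v.adicCompletion ℚ)) u)))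
  {q : v.adicCompletion ℚ} (hq0 : q ≠ 0) (hq1 : Valued.v q < 1)
  (hker : ∀ u : (AlgebraicClosure (v.adicCompletion ℚ))ˣ, Φ (Additive.ofMul u) = 0 →
    ∃ a : ℤ, (u : AlgebraicClosure (v.adicCompletion ℚ)) =
      algebraMap (v.adicCompletion ℚ) (AlgebraicClosure (v.adicCompletion ℚ)) q ^ a)
  (hΦI : ∀ σ ∈ absInertia (v.adicCompletion ℚ), ∀ u : (AlgebraicClosure (v.adicCompletion ℚ))ˣ,
    σ • Φ (Additive.ofMul u) = Φ (Additive.ofMul (Units.map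
      (Field.absoluteGaloisGroup.toAlgEquiv (v.adicCompletion ℚ) σ :
        AlgebraicClosure (v.adicCompletion ℚ) →* AlgebraicClosure (v.adicCompletion ℚ)) u)))

include hq0 hq1 hker hΦI in
/-- **Uniqueness of the Tate line (odd `p`, `v ∋ p` with a Tate parametrisation)**: a local datum
`C'` of `E[p^∞]` with inertia-trivial quotient (`x•m − m ∈ C'` for `x ∈ I_v`) and
`#(C' ∩ E[p^∞][p]) = p` EQUALS the Tate datum `C = ι⁻¹Φ(μ)`: `C ⊆ C'`
(`tateDatum_plus_le_of_inertia`), `C` divisible (`tateDatum_plus_divisible`), `#C[p] = p`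
(`natCard_tateDatum_plus_inf_torsionBy`), §1. GV p. 16: "`W_p` … invariant under the action of
`G_{ℚ_p}`. Let `C` denote the image of `W_p` in `A`" — at `p ‖ N` there is exactly one such line
with unramified quotient. [cite: GreenbergVatsal2000, §2 pp. 14–16]
[cite: SilvermanATAEC1994, Ch. V Thm. 3.1 (c),(d)] -/
theorem plus_eq_tateDatum_plus_of_inertia (hp2 : p ≠ 2) (hpv : ((p : ℕ) : 𝓞 ℚ) ∈ v.asIdeal)
    (N' : LocalDatum ℚ (W.geomPrimaryTorsion p) v)
    (htriv' : ∀ x ∈ inertia v, ∀ m : W.geomPrimaryTorsion p, x • m - m ∈ N'.plus)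
    (hcard' : Nat.card ↥(N'.plus ⊓ (↥(W.geomPrimaryTorsion p))[(p : ℤ)]) = p) :
    N'.plus = (tateDatum W p Φ hΦ).plus := by
  symm
  refine eq_of_le_of_divisible_of_card_eq p
    (tateDatum_plus_le_of_inertia W p Φ hΦ hq0 hq1 hker hΦI hp2 hpv N' htriv') ?_
    (tateDatum_plus_divisible W p Φ hΦ) (by rw [hcard']; exact hp.out.ne_zero) ?_
  · intro m _
    obtain ⟨k, hk⟩ := (AddCommGroup.mem_primaryComponent).1 m.2
    exact ⟨k, Subtype.ext (by rw [AddSubmonoidClass.coe_nsmul, ZeroMemClass.coe_zero]; exact hk)⟩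
  · rw [natCard_tateDatum_plus_inf_torsionBy W p Φ hΦ hq0 hq1 hker, hcard']

end Tate

/-! ## §3. At an odd SPLIT `p ‖ N`: GV's datum is unique (granted A40) -/

section Split

variable (W : WeierstrassCurve ℚ) [W.IsElliptic] (p : ℕ) [hp : Fact p.Prime]

/-- **Any two Greenberg data of `E[p^∞]` at an odd split `p ‖ N` with inertia-trivial quotients and
`#(C ∩ A[p]) = p` coincide above `p`** (both equal the Tate line of any parametrisation supplied by
A40, §2). Together with gen 13's `exists_data_of_split` this is the existence-and-uniqueness of the
datum over which A133 / A135 / A137 / A137′ quantify at a split prime.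
[cite: GreenbergVatsal2000, §2 pp. 14–16] [cite: SilvermanATAEC1994, Ch. V Thm. 3.1 (c),(d) and Thm. 5.3 (a),(b)] -/
theorem plus_eq_plus_of_inertia_of_split (hT : Silverman1994_thmV53_tateUniformisation.{0})
    (hp2 : p ≠ 2) (hsplit : W.HasSplitMultiplicativeReductionAtPrime p)
    (L L' : Data ℚ (W.geomPrimaryTorsion p) p)
    (htriv : ∀ (v : HeightOneSpectrum (𝓞 ℚ)) (hv : ((p : ℕ) : 𝓞 ℚ) ∈ v.asIdeal),
      ∀ x ∈ inertia v, ∀ m : W.geomPrimaryTorsion p, x • m - m ∈ (L v hv).plus)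
    (hcard : ∀ (v : HeightOneSpectrum (𝓞 ℚ)) (hv : ((p : ℕ) : 𝓞 ℚ) ∈ v.asIdeal),
      Nat.card ↥((L v hv).plus ⊓ (↥(W.geomPrimaryTorsion p))[(p : ℤ)]) = p)
    (htriv' : ∀ (v : HeightOneSpectrum (𝓞 ℚ)) (hv : ((p : ℕ) : 𝓞 ℚ) ∈ v.asIdeal),
      ∀ x ∈ inertia v, ∀ m : W.geomPrimaryTorsion p, x • m - m ∈ (L' v hv).plus)
    (hcard' : ∀ (v : HeightOneSpectrum (𝓞 ℚ)) (hv : ((p : ℕ) : 𝓞 ℚ) ∈ v.asIdeal),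
      Nat.card ↥((L' v hv).plus ⊓ (↥(W.geomPrimaryTorsion p))[(p : ℤ)]) = p) :
    ∀ (v : HeightOneSpectrum (𝓞 ℚ)) (hv : ((p : ℕ) : 𝓞 ℚ) ∈ v.asIdeal),
      (L v hv).plus = (L' v hv).plus := by
  intro v hv
  obtain ⟨q, Φ, hq0, hq1, -, hker, hΦσ, -⟩ :=
    hT W v (hasSplitMultiplicativeReductionAt_of_mem W p hsplit hv)
  rw [plus_eq_tateDatum_plus_of_inertia W p Φ (sign_disj W Φ 0 (sign_of_equivariant W Φ hΦσ)) hq0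
      hq1 (fun u h ↦ (hker u).1 h) (fun σ _ u ↦ hΦσ σ u) hp2 hv (L v hv) (htriv v hv) (hcard v hv),
    plus_eq_tateDatum_plus_of_inertia W p Φ (sign_disj W Φ 0 (sign_of_equivariant W Φ hΦσ)) hq0
      hq1 (fun u h ↦ (hker u).1 h) (fun σ _ u ↦ hΦσ σ u) hp2 hv (L' v hv) (htriv' v hv) (hcard' v hv)]

/-- **The local conditions agree**: two such data have the same `greenbergKer` and `strictKer` at
every `v ∋ p` over any `H ≤ Γ_ℚ` (the kernels depend on the datum only through `plus`), hence the
same datum Selmer groups — so the X2 records' "for all data `L` …" at a split prime are statements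
about ONE pair of groups `S_A(ℚ_∞) ⊇ S^{str}_A(ℚ_∞)`. Bookkeeping (`LocalDatum` is determined by
its `plus` field). [cite: GreenbergVatsal2000, §2 pp. 14–16] -/
theorem localDatum_eq_of_inertia_of_split (hT : Silverman1994_thmV53_tateUniformisation.{0})
    (hp2 : p ≠ 2) (hsplit : W.HasSplitMultiplicativeReductionAtPrime p)
    (L L' : Data ℚ (W.geomPrimaryTorsion p) p)
    (htriv : ∀ (v : HeightOneSpectrum (𝓞 ℚ)) (hv : ((p : ℕ) : 𝓞 ℚ) ∈ v.asIdeal),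
      ∀ x ∈ inertia v, ∀ m : W.geomPrimaryTorsion p, x • m - m ∈ (L v hv).plus)
    (hcard : ∀ (v : HeightOneSpectrum (𝓞 ℚ)) (hv : ((p : ℕ) : 𝓞 ℚ) ∈ v.asIdeal),
      Nat.card ↥((L v hv).plus ⊓ (↥(W.geomPrimaryTorsion p))[(p : ℤ)]) = p)
    (htriv' : ∀ (v : HeightOneSpectrum (𝓞 ℚ)) (hv : ((p : ℕ) : 𝓞 ℚ) ∈ v.asIdeal),
      ∀ x ∈ inertia v, ∀ m : W.geomPrimaryTorsion p, x • m - m ∈ (L' v hv).plus)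
    (hcard' : ∀ (v : HeightOneSpectrum (𝓞 ℚ)) (hv : ((p : ℕ) : 𝓞 ℚ) ∈ v.asIdeal),
      Nat.card ↥((L' v hv).plus ⊓ (↥(W.geomPrimaryTorsion p))[(p : ℤ)]) = p) :
    L = L' := by
  funext v hv
  have h := plus_eq_plus_of_inertia_of_split W p hT hp2 hsplit L L' htriv hcard htriv' hcard' v hv
  cases hL : L v hv with
  | mk plus smul_mem =>
    cases hL' : L' v hv with
    | mk plus' smul_mem' =>
      rw [hL, hL'] at h
      change plus = plus' at h
      subst h
      rfl

end Split

end Summit.BirchSwinnertonDyer.Rank1Residual.X2.TateLineUnique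

end

/-! ## §4 (appended, gen 27). Any odd MULTIPLICATIVE prime (split or non-split): GV's datum is
unique, granted the twisted Tate uniformisation A41 — inertia still acts on the twisted Tate line
`C ≅ μ_{p^∞} ⊗ δ` through `χ_p` (`δ` unramified: `K_v(√γ)/K_v` is unramified for a minimal model,
gen 12 `inertia_fix_sqrt_gamma`), so §2 applies verbatim. -/

noncomputable section

open scoped Classical AddSubgroup

namespace Summit.BirchSwinnertonDyer.Rank1Residual.X2.TateLineUnique

open NumberField IsDedekindDomain Field WeierstrassCurve
  Literature.NumberTheory.GaloisRepresentations
  Literature.NumberTheory.EllipticCurves Literature.NumberTheory.EllipticCurves.GreenbergSelmer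
  Literature.NumberTheory.EllipticCurves.GreenbergVatsal2000 IsDedekindDomain.HeightOneSpectrum
  Summit.BirchSwinnertonDyer.Rank1Residual.X2.GreenbergVatsalTorsion
  Summit.BirchSwinnertonDyer.Rank1Residual.X2.GreenbergVatsalTateDatum
  Summit.BirchSwinnertonDyer.Rank1Residual.X2.GreenbergVatsalTateDatumSign
  Summit.BirchSwinnertonDyer.Rank1Residual.X2.GreenbergVatsalTateDatumCofree
  Summit.BirchSwinnertonDyer.Rank1Residual.X2.GreenbergVatsalStrictSelmerMultiplicative
  Summit.BirchSwinnertonDyer.Rank1Residual.X2.TrivialZeroStrictInclusionDerived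

variable (W : WeierstrassCurve ℚ) [W.IsElliptic] [W.IsGloballyMinimal] (p : ℕ) [hp : Fact p.Prime]

/-- **Any two Greenberg data of `E[p^∞]` at an odd MULTIPLICATIVE `p ‖ N` (split or non-split; `E`
globally minimal) with inertia-trivial quotients and `#(C ∩ A[p]) = p` coincide above `p`**, granted
A41 (`hT'`): both equal the (twisted) Tate line `ι⁻¹Ψ(μ)` of the parametrisation of Silverman
V.5.3/V.5.4, on which the local inertia group acts through `χ_p` because it fixes `√γ(E)`
(`GreenbergVatsalTateDatumRat.inertia_fix_sqrt_gamma`). With gen 13's `exists_data_of_not_split` /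
`exists_data_of_split`: existence-and-uniqueness of the datum of A133 / A135 / T-GV23L at `p ‖ N`.
[cite: GreenbergVatsal2000, §2 pp. 14–16] [cite: GreenbergLNM1716, p. 93 (PDF p. 93)]
[cite: SilvermanATAEC1994, Ch. V Lemma 5.2 (c), Thm. 5.3 (a),(b), Cor. 5.4] -/
theorem plus_eq_plus_of_inertia_of_multiplicative
    (hT' : Silverman1994_thmV53_corV54_tateUniformisation.{0})
    (hp2 : p ≠ 2) (hmult : W.HasMultiplicativeReductionAtPrime p)
    (L L' : Data ℚ (W.geomPrimaryTorsion p) p)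
    (htriv : ∀ (v : HeightOneSpectrum (𝓞 ℚ)) (hv : ((p : ℕ) : 𝓞 ℚ) ∈ v.asIdeal),
      ∀ x ∈ inertia v, ∀ m : W.geomPrimaryTorsion p, x • m - m ∈ (L v hv).plus)
    (hcard : ∀ (v : HeightOneSpectrum (𝓞 ℚ)) (hv : ((p : ℕ) : 𝓞 ℚ) ∈ v.asIdeal),
      Nat.card ↥((L v hv).plus ⊓ (↥(W.geomPrimaryTorsion p))[(p : ℤ)]) = p)
    (htriv' : ∀ (v : HeightOneSpectrum (𝓞 ℚ)) (hv : ((p : ℕ) : 𝓞 ℚ) ∈ v.asIdeal),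
      ∀ x ∈ inertia v, ∀ m : W.geomPrimaryTorsion p, x • m - m ∈ (L' v hv).plus)
    (hcard' : ∀ (v : HeightOneSpectrum (𝓞 ℚ)) (hv : ((p : ℕ) : 𝓞 ℚ) ∈ v.asIdeal),
      Nat.card ↥((L' v hv).plus ⊓ (↥(W.geomPrimaryTorsion p))[(p : ℤ)]) = p) :
    ∀ (v : HeightOneSpectrum (𝓞 ℚ)) (hv : ((p : ℕ) : 𝓞 ℚ) ∈ v.asIdeal),
      (L v hv).plus = (L' v hv).plus := by
  intro v hv
  obtain ⟨q, t, Ψ, hq0, hq1, -, ht2, -, hker, hΨσ, -⟩ :=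
    hT' W v (hasMultiplicativeReductionAt_of_mem W p hmult hv)
  have hΨI : ∀ σ ∈ absInertia (v.adicCompletion ℚ),
      ∀ u : (AlgebraicClosure (v.adicCompletion ℚ))ˣ,
      σ • Ψ (Additive.ofMul u) = Ψ (Additive.ofMul (Units.map
        (Field.absoluteGaloisGroup.toAlgEquiv (v.adicCompletion ℚ) σ :
          AlgebraicClosure (v.adicCompletion ℚ) →* AlgebraicClosure (v.adicCompletion ℚ)) u)) := by
    intro σ hσ u
    rw [hΨσ σ u, if_pos (GreenbergVatsalTateDatumRat.inertia_fix_sqrt_gamma W hp2 hmult hv t ht2 σ hσ),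
      one_zsmul]
  rw [plus_eq_tateDatum_plus_of_inertia W p Ψ (sign_disj W Ψ t hΨσ) hq0 hq1
      (fun u h ↦ (hker u).1 h) hΨI hp2 hv (L v hv) (htriv v hv) (hcard v hv),
    plus_eq_tateDatum_plus_of_inertia W p Ψ (sign_disj W Ψ t hΨσ) hq0 hq1
      (fun u h ↦ (hker u).1 h) hΨI hp2 hv (L' v hv) (htriv' v hv) (hcard' v hv)]

/-- The data themselves coincide (`LocalDatum` is determined by `plus`). Bookkeeping.
[cite: GreenbergVatsal2000, §2 pp. 14–16] -/
theorem data_eq_of_inertia_of_multiplicative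
    (hT' : Silverman1994_thmV53_corV54_tateUniformisation.{0})
    (hp2 : p ≠ 2) (hmult : W.HasMultiplicativeReductionAtPrime p)
    (L L' : Data ℚ (W.geomPrimaryTorsion p) p)
    (htriv : ∀ (v : HeightOneSpectrum (𝓞 ℚ)) (hv : ((p : ℕ) : 𝓞 ℚ) ∈ v.asIdeal),
      ∀ x ∈ inertia v, ∀ m : W.geomPrimaryTorsion p, x • m - m ∈ (L v hv).plus)
    (hcard : ∀ (v : HeightOneSpectrum (𝓞 ℚ)) (hv : ((p : ℕ) : 𝓞 ℚ) ∈ v.asIdeal),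
      Nat.card ↥((L v hv).plus ⊓ (↥(W.geomPrimaryTorsion p))[(p : ℤ)]) = p)
    (htriv' : ∀ (v : HeightOneSpectrum (𝓞 ℚ)) (hv : ((p : ℕ) : 𝓞 ℚ) ∈ v.asIdeal),
      ∀ x ∈ inertia v, ∀ m : W.geomPrimaryTorsion p, x • m - m ∈ (L' v hv).plus)
    (hcard' : ∀ (v : HeightOneSpectrum (𝓞 ℚ)) (hv : ((p : ℕ) : 𝓞 ℚ) ∈ v.asIdeal),
      Nat.card ↥((L' v hv).plus ⊓ (↥(W.geomPrimaryTorsion p))[(p : ℤ)]) = p) :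
    L = L' := by
  funext v hv
  have h := plus_eq_plus_of_inertia_of_multiplicative W p hT' hp2 hmult L L' htriv hcard htriv'
    hcard' v hv
  cases hL : L v hv with
  | mk plus smul_mem =>
    cases hL' : L' v hv with
    | mk plus' smul_mem' =>
      rw [hL, hL'] at h
      change plus = plus' at h
      subst h
      rfl

end Summit.BirchSwinnertonDyer.Rank1Residual.X2.TateLineUnique

end
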